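/-
Origin: expansion seat `prover-pub-hodgecm-mc-sinst-1-g3-0`, handover #1209 2026-08-20T04:49Z md5 77d34403b8c6 (223 l.) NEW additive drop-alone leaf after RUN-37 ThetaAdelicSideLF; predicate-guarded total S family SInstance.SGP (any guard G with hG : G → plane definite at ι₁; instances hG_goodCtx/O/OG), row 13 hypothesis-free; drop alone on bounce; NAME LIST: HodgeCM.Model.SInstance.hT_P · HodgeCM.Model.SInstance.SGP_eq_archSideOf · HodgeCM.Model.ArchSideTerm.thetaAdelicSideOfP_eq_archSideOf) (`HOME/mc/pub-hodgecm-mc-sinst-1-g3/stage/HodgeCM/Model/ThetaAdelicSideGuardedP.lean`, md5 77d34403b8c6, 223 lines);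
landed by the gen-15 packager (p-g15) in gate run 41 as `HodgeCM/Model/ThetaAdelicSideGuardedP.lean` (verbatim).
-/
/-
Origin: speedrun cell pub-hodgecm, MODEL-CONSTRUCTION sub-cell, lineage mc-sinst-1 (S-instance constructor, BINDER-OWNERS row 5 `S` + row 13 `hT`),
seat prover-pub-hodgecm-mc-sinst-1-g3-0 (gen 3), 2026-08-20 (re-cut of gen-0's staged `ThetaAdelicSideGuarded.lean` 270f31a651d0 with the guard made a PARAMETER).
Target in PKG: `HodgeCM/Model/ThetaAdelicSideGuardedP.lean` (NEW additive drop-alone leaf; RUN 42± material; imports installed RUN-37 `Model/ThetaAdelicSideLF` only).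
KERNEL only: 0 records / `def … : Prop` / cites, 0 proof holes; intended closure {propext, Classical.choice, Quot.sound}.
-/
import Summits.HodgeConjecture.HodgeCM.Model.ThetaAdelicSideLF

/-!
# The PREDICATE-GUARDED total S family `SInstance.SGP` — the S pin for a GUARDED datum family, for ANY guard

`ThetaAdelicSideInstance.thetaAdelicSideOf` (#1201) guards on the sign fact `h₁W` and takes the archimedean line inputs `A k` OUTSIDE the guard
(right when the datum family `𝔄 : ∀ V c, ArchLineDatum …` is inhabited at EVERY context).  The (J-μ) weight identities inside the datum are
dischargeable only UNDER a guard (their read-off `Model/ArchLineSlotType(Cont)` needs plane-definiteness at `ι₁` for the continuity of the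
see-saw characters; off the guard the slot types are not even defined), and under (ORIENT-h)/(c̄) E's end state is GUARDED anyway
(`(InfinitePlace.mk ι₁).embedding = ι₁ → GoodCtx (hb L ι₁) ι₁ c → …`, glue-1 G1/G3).  So the honest S pin receives a GUARDED datum family.
This leaf provides it once for EVERY guard: a family of Props `G V c` with the single requirement `hG : G V c → (plane dW definite at ι₁)`:

  `thetaAdelicSideOfP V c G hG hGR hGR₀ hGR₁ hGR₂ hGR₃ η hη hηc AG := if hc : G then archSideOf V c … (hG hc) (AG hc) else Sanity.degThetaAdelicSide₀ V c`

with `AG : G → ∀ k, ArchLineInput V (lineRepD … k)` (so `AG hc k := archLineInputOf (𝔄G V c hc) k` for a guarded datum family), the read-back API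
with `hc : G V c`, row 13 `hT` / `hLF` HYPOTHESIS-FREE on both branches, and the E-currency family
`SInstance.SGP @G @hG @hGR @η @hη @hηc @hGR₀ @hGR₁ @hGR₂ @hGR₃ @AG : ∀ {L ι₁} V c, ThetaAdelicSide V c`.
Instances (the caller's choice of `G`, `hG`): `G := SignRecipe.GoodCtx h ι₁ c` (gen-0's `SG`, `hG := dW_definite_of_goodCtx ι₁ c h`);
`G := SignRecipe.GoodCtx (hb L ι₁) ι₁ c` ((o)); `G := (InfinitePlace.mk ι₁).embedding = ι₁ ∧ SignRecipe.GoodCtx (hb L ι₁) ι₁ c` ((c̄)+(o), `hG := … ∘ And.right`).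
Nothing here is a claim of PerL/QW8; nothing is cited as a fact.
-/

set_option autoImplicit false

noncomputable section

open scoped Matrix SchwartzMap
open NumberField NumberField.mixedEmbedding
open Literature.NumberTheory.Automorphic Literature.NumberTheory.Weil1964
open Literature.NumberTheory.GelbartRogawski1991.UnitaryDualPair
open HodgeCM.Adelic HodgeCM.PerL34
open Literature.Geometry.ComplexHyperbolic.BallModel (U21)
open Literature.AlgebraicGeometry.HodgeTheory
open Literature.NumberTheory.Automorphic.PicardCM

namespace HodgeCM.Model

namespace ArchSideTerm

section GuardedP

variable {L : CMField} {ι₁ : L →+* ℂ} (V : HermSpace3 L ι₁) (c : SeesawCtx L) (G : Prop)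
  (hG : G → (∀ j, 0 < (ι₁ (dW c.D j)).re) ∨ ∀ j, (ι₁ (dW c.D j)).re < 0)
  (hGR : (cmSplittingDatum (L : Type) finProdFinEquiv (frameD V) (frameD_real V) (frameD_ne V) (dW c.D) (dW_real c.D)
    (dW_ne c.D)).CompatibleSplitting)
  (hGR₀ : (cmSplittingDatum (L : Type) (e₁) (frameD V) (frameD_real V) (frameD_ne V) (lineVec (L : Type) (dW c.D 0))
    (fun _ => dW_real c.D 0) (fun _ => dW_ne c.D 0)).CompatibleSplitting)
  (hGR₁ : (cmSplittingDatum (L : Type) (e₁) (frameD V) (frameD_real V) (frameD_ne V) (lineVec (L : Type) (dW c.D 1))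
    (fun _ => dW_real c.D 1) (fun _ => dW_ne c.D 1)).CompatibleSplitting)
  (hGR₂ : (cmSplittingDatum (L : Type) (e₁) (frameD V) (frameD_real V) (frameD_ne V) (lineVec (L : Type) (dW' c.D 0))
    (fun _ => dW'_real c.D 0) (fun _ => dW'_ne c.D 0)).CompatibleSplitting)
  (hGR₃ : (cmSplittingDatum (L : Type) (e₁) (frameD V) (frameD_real V) (frameD_ne V) (lineVec (L : Type) (dW' c.D 1))
    (fun _ => dW'_real c.D 1) (fun _ => dW'_ne c.D 1)).CompatibleSplitting)
  (η : CMAdelic (L : Type) (frameD V) × CMAdelic (L : Type) (dW c.D) →* ℂˣ)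
  (hη : ∀ γU ∈ CMRat (L : Type) (frameD V), ∀ γ ∈ CMRat (L : Type) (dW c.D), η (γU, γ) = 1)
  (hηc : Continuous fun p => ((η p : ℂˣ) : ℂ))
  (AG : G → ∀ k : Fin 4, ArchLineInput V (lineRepD V c.D hGR hGR₀ hGR₁ hGR₂ hGR₃ η k))

open scoped Classical in
/-- **The PREDICATE-GUARDED total S term**: period-1's `archSideOf` under the guard `G` (the archimedean inputs may use `hc : G`),
sanity-1's degenerate side elsewhere. -/
def thetaAdelicSideOfP : ThetaAdelicSide V c :=
  if hc : G then archSideOf V c hGR hGR₀ hGR₁ hGR₂ hGR₃ η hη hηc (hG hc) (AG hc) else Sanity.degThetaAdelicSide₀ V c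

/-- Under the guard the term IS period-1's term (`dif_pos`). -/
theorem thetaAdelicSideOfP_eq_archSideOf (hc : G) :
    thetaAdelicSideOfP V c G hG hGR hGR₀ hGR₁ hGR₂ hGR₃ η hη hηc AG =
      archSideOf V c hGR hGR₀ hGR₁ hGR₂ hGR₃ η hη hηc (hG hc) (AG hc) := by
  classical
  exact dif_pos hc

/-- Off the guard the term is the degenerate side (`dif_neg`). -/
theorem thetaAdelicSideOfP_eq_degThetaAdelicSide₀ (hc : ¬ G) :
    thetaAdelicSideOfP V c G hG hGR hGR₀ hGR₁ hGR₂ hGR₃ η hη hηc AG = Sanity.degThetaAdelicSide₀ V c := by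
  classical
  exact dif_neg hc

/-! ### read-backs under the guard -/

/-- (Ported verbatim from the HodgeCMPerL package; no docstring in the source.) -/
theorem thetaAdelicSideOfP_P_ΓU (k : Fin 4) :
    ((thetaAdelicSideOfP V c G hG hGR hGR₀ hGR₁ hGR₂ hGR₃ η hη hηc AG).P k).ΓU = (V.latticeModel printFact_unitaryCompact_holds).Γ :=
  (thetaAdelicSideOfP V c G hG hGR hGR₀ hGR₁ hGR₂ hGR₃ η hη hηc AG).hΓU k

/-- (Ported verbatim from the HodgeCMPerL package; no docstring in the source.) -/
theorem thetaAdelicSideOfP_P_ω (hc : G) (k : Fin 4) :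
    ((thetaAdelicSideOfP V c G hG hGR hGR₀ hGR₁ hGR₂ hGR₃ η hη hηc AG).P k).ω =
      lineRepOf V c.D hGR hGR₀ hGR₁ hGR₂ hGR₃ (eta₀ V c.D η) (eta₁ V c.D η) (eta₂ V c.D η) (eta₃ V c.D η) k := by
  rw [thetaAdelicSideOfP_eq_archSideOf V c G hG hGR hGR₀ hGR₁ hGR₂ hGR₃ η hη hηc AG hc]; rfl

/-- (Ported verbatim from the HodgeCMPerL package; no docstring in the source.) -/
theorem thetaAdelicSideOfP_ιinf (hc : G) :
    (thetaAdelicSideOfP V c G hG hGR hGR₀ hGR₁ hGR₂ hGR₃ η hη hηc AG).ιinf = archInfOf V := by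
  rw [thetaAdelicSideOfP_eq_archSideOf V c G hG hGR hGR₀ hGR₁ hGR₂ hGR₃ η hη hηc AG hc]; rfl

/-- (Ported verbatim from the HodgeCMPerL package; no docstring in the source.) -/
theorem thetaAdelicSideOfP_Gfin (hc : G) :
    (thetaAdelicSideOfP V c G hG hGR hGR₀ hGR₁ hGR₂ hGR₃ η hη hηc AG).Gfin = archFinOf V := by
  rw [thetaAdelicSideOfP_eq_archSideOf V c G hG hGR hGR₀ hGR₁ hGR₂ hGR₃ η hη hηc AG hc]; rfl

/-- (Ported verbatim from the HodgeCMPerL package; no docstring in the source.) -/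
theorem thetaAdelicSideOfP_P_Φinf (hc : G) (k : Fin 4) :
    ((thetaAdelicSideOfP V c G hG hGR hGR₀ hGR₁ hGR₂ hGR₃ η hη hηc AG).P k).Φinf = (AG hc k).Φinf := by
  rw [thetaAdelicSideOfP_eq_archSideOf V c G hG hGR hGR₀ hGR₁ hGR₂ hGR₃ η hη hηc AG hc]; rfl

/-- (Ported verbatim from the HodgeCMPerL package; no docstring in the source.) -/
theorem thetaAdelicSideOfP_P_x₀ (hc : G) (k : Fin 4) :
    ((thetaAdelicSideOfP V c G hG hGR hGR₀ hGR₁ hGR₂ hGR₃ η hη hηc AG).P k).x₀ = (AG hc k).x₀ := by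
  rw [thetaAdelicSideOfP_eq_archSideOf V c G hG hGR hGR₀ hGR₁ hGR₂ hGR₃ η hη hηc AG hc]; rfl

/-- (Ported verbatim from the HodgeCMPerL package; no docstring in the source.) -/
theorem thetaAdelicSideOfP_P_w (hc : G) (k : Fin 4) :
    ((thetaAdelicSideOfP V c G hG hGR hGR₀ hGR₁ hGR₂ hGR₃ η hη hηc AG).P k).w = (AG hc k).w := by
  rw [thetaAdelicSideOfP_eq_archSideOf V c G hG hGR hGR₀ hGR₁ hGR₂ hGR₃ η hη hηc AG hc]; rfl

/-- (Ported verbatim from the HodgeCMPerL package; no docstring in the source.) -/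
theorem thetaAdelicSideOfP_ιinf_apply (hc : G) (hV : IsAnisotropic L V.Hm) (u : U21) :
    (thetaAdelicSideOfP V c G hG hGR hGR₀ hGR₁ hGR₂ hGR₃ η hη hηc AG).ιinf u =
      Adelic.regimeEquiv L V.Hm hV
        (UnitaryGroup.archSectionU21CM (L : Type) ι₁ V.Hm V.sylvesterFrame (sylvesterFrame_J V) u) := by
  rw [thetaAdelicSideOfP_eq_archSideOf V c G hG hGR hGR₀ hGR₁ hGR₂ hGR₃ η hη hηc AG hc]
  exact archSideOf_ιinf_apply V c hGR hGR₀ hGR₁ hGR₂ hGR₃ η hη hηc _ (AG hc) hV u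

/-! ### row 13 on both branches, hypothesis-free -/

/-- `hLF` at the guarded term. -/
theorem isLFAction_thetaAdelicSideOfP (k : Fin 4) :
    ((thetaAdelicSideOfP V c G hG hGR hGR₀ hGR₁ hGR₂ hGR₃ η hη hηc AG).P k).IsLFAction := by
  by_cases hc : G
  · rw [thetaAdelicSideOfP_eq_archSideOf V c G hG hGR hGR₀ hGR₁ hGR₂ hGR₃ η hη hηc AG hc]
    exact isLFAction_archSideOf V c hGR hGR₀ hGR₁ hGR₂ hGR₃ η hη hηc _ (AG hc) k
  · rw [thetaAdelicSideOfP_eq_degThetaAdelicSide₀ V c G hG hGR hGR₀ hGR₁ hGR₂ hGR₃ η hη hηc AG hc]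
    exact Sanity.isLFAction_degThetaAdelicSide₀ V c k

/-- Row 13 `hT` at the guarded term. -/
theorem isThetaArchContinuous_thetaAdelicSideOfP (k : Fin 4) (N : ℕ) :
    ((thetaAdelicSideOfP V c G hG hGR hGR₀ hGR₁ hGR₂ hGR₃ η hη hηc AG).P k).IsThetaArchContinuous N :=
  ((thetaAdelicSideOfP V c G hG hGR hGR₀ hGR₁ hGR₂ hGR₃ η hη hηc AG).P k).isThetaArchContinuous_of_isLFContinuous
    (isLFAction_thetaAdelicSideOfP V c G hG hGR hGR₀ hGR₁ hGR₂ hGR₃ η hη hηc AG k) N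

end GuardedP

end ArchSideTerm

/-! ## E currency -/

namespace SInstance

open HodgeCM.Model.ArchSideTerm

variable
  (G : ∀ {L : CMField} {ι₁ : L →+* ℂ} (_V : HermSpace3 L ι₁) (_c : SeesawCtx L), Prop)
  (hG : ∀ {L : CMField} {ι₁ : L →+* ℂ} (V : HermSpace3 L ι₁) (c : SeesawCtx L),
    G V c → (∀ j, 0 < (ι₁ (dW c.D j)).re) ∨ ∀ j, (ι₁ (dW c.D j)).re < 0)
  (hGR : ∀ {L : CMField} {ι₁ : L →+* ℂ} (V : HermSpace3 L ι₁) (c : SeesawCtx L),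
    (cmSplittingDatum (L : Type) finProdFinEquiv (frameD V) (frameD_real V) (frameD_ne V) (dW c.D) (dW_real c.D)
      (dW_ne c.D)).CompatibleSplitting)
  (η : ∀ {L : CMField} {ι₁ : L →+* ℂ} (V : HermSpace3 L ι₁) (c : SeesawCtx L),
    CMAdelic (L : Type) (frameD V) × CMAdelic (L : Type) (dW c.D) →* ℂˣ)
  (hη : ∀ {L : CMField} {ι₁ : L →+* ℂ} (V : HermSpace3 L ι₁) (c : SeesawCtx L),
    ∀ γU ∈ CMRat (L : Type) (frameD V), ∀ γ ∈ CMRat (L : Type) (dW c.D), η V c (γU, γ) = 1)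
  (hηc : ∀ {L : CMField} {ι₁ : L →+* ℂ} (V : HermSpace3 L ι₁) (c : SeesawCtx L), Continuous fun p => ((η V c p : ℂˣ) : ℂ))
  (hGR₀ : ∀ {L : CMField} {ι₁ : L →+* ℂ} (V : HermSpace3 L ι₁) (c : SeesawCtx L),
    (cmSplittingDatum (L : Type) (e₁) (frameD V) (frameD_real V) (frameD_ne V) (lineVec (L : Type) (dW c.D 0))
      (fun _ => dW_real c.D 0) (fun _ => dW_ne c.D 0)).CompatibleSplitting)
  (hGR₁ : ∀ {L : CMField} {ι₁ : L →+* ℂ} (V : HermSpace3 L ι₁) (c : SeesawCtx L),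
    (cmSplittingDatum (L : Type) (e₁) (frameD V) (frameD_real V) (frameD_ne V) (lineVec (L : Type) (dW c.D 1))
      (fun _ => dW_real c.D 1) (fun _ => dW_ne c.D 1)).CompatibleSplitting)
  (hGR₂ : ∀ {L : CMField} {ι₁ : L →+* ℂ} (V : HermSpace3 L ι₁) (c : SeesawCtx L),
    (cmSplittingDatum (L : Type) (e₁) (frameD V) (frameD_real V) (frameD_ne V) (lineVec (L : Type) (dW' c.D 0))
      (fun _ => dW'_real c.D 0) (fun _ => dW'_ne c.D 0)).CompatibleSplitting)
  (hGR₃ : ∀ {L : CMField} {ι₁ : L →+* ℂ} (V : HermSpace3 L ι₁) (c : SeesawCtx L),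
    (cmSplittingDatum (L : Type) (e₁) (frameD V) (frameD_real V) (frameD_ne V) (lineVec (L : Type) (dW' c.D 1))
      (fun _ => dW'_real c.D 1) (fun _ => dW'_ne c.D 1)).CompatibleSplitting)
  (AG : ∀ {L : CMField} {ι₁ : L →+* ℂ} (V : HermSpace3 L ι₁) (c : SeesawCtx L), G V c → ∀ k : Fin 4,
    ArchLineInput V (lineRepD V c.D (hGR V c) (hGR₀ V c) (hGR₁ V c) (hGR₂ V c) (hGR₃ V c) (η V c) k))

/-- **The PREDICATE-GUARDED total S family** (E's `S` pin for a guarded datum family, any guard `G` with `hG : G → plane definite at ι₁`). -/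
abbrev SGP : ∀ {L : CMField} {ι₁ : L →+* ℂ} (V : HermSpace3 L ι₁) (c : SeesawCtx L), ThetaAdelicSide V c :=
  fun V c => thetaAdelicSideOfP V c (G V c) (hG V c) (hGR V c) (hGR₀ V c) (hGR₁ V c) (hGR₂ V c) (hGR₃ V c) (η V c) (hη V c) (hηc V c) (AG V c)

variable {L : CMField} {ι₁ : L →+* ℂ} (V : HermSpace3 L ι₁) (c : SeesawCtx L)

/-- (Ported verbatim from the HodgeCMPerL package; no docstring in the source.) -/
theorem SGP_apply : SGP @G @hG @hGR @η @hη @hηc @hGR₀ @hGR₁ @hGR₂ @hGR₃ @AG V c =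
    thetaAdelicSideOfP V c (G V c) (hG V c) (hGR V c) (hGR₀ V c) (hGR₁ V c) (hGR₂ V c) (hGR₃ V c) (η V c) (hη V c) (hηc V c) (AG V c) := rfl

/-- Under the guard the family IS period-1's term. -/
theorem SGP_eq_archSideOf (hc : G V c) :
    SGP @G @hG @hGR @η @hη @hηc @hGR₀ @hGR₁ @hGR₂ @hGR₃ @AG V c =
      archSideOf V c (hGR V c) (hGR₀ V c) (hGR₁ V c) (hGR₂ V c) (hGR₃ V c) (η V c) (hη V c) (hηc V c) (hG V c hc) (AG V c hc) :=
  thetaAdelicSideOfP_eq_archSideOf V c (G V c) _ _ _ _ _ _ _ _ _ _ hc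

/-- E's `hLF` at the guarded family, hypothesis-free. -/
theorem hLF_P : ∀ {L : CMField} {ι₁ : L →+* ℂ} (V : HermSpace3 L ι₁) (c : SeesawCtx L) (k : Fin 4),
    ((SGP @G @hG @hGR @η @hη @hηc @hGR₀ @hGR₁ @hGR₂ @hGR₃ @AG V c).P k).IsLFAction :=
  fun V c k => isLFAction_thetaAdelicSideOfP V c (G V c) _ _ _ _ _ _ _ _ _ _ k

/-- E's row-13 `hT` at the guarded family, hypothesis-free. -/
theorem hT_P : ∀ {L : CMField} {ι₁ : L →+* ℂ} (V : HermSpace3 L ι₁) (c : SeesawCtx L) (k : Fin 4) (N : ℕ),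
    ((SGP @G @hG @hGR @η @hη @hηc @hGR₀ @hGR₁ @hGR₂ @hGR₃ @AG V c).P k).IsThetaArchContinuous N :=
  fun V c k N => isThetaArchContinuous_thetaAdelicSideOfP V c (G V c) _ _ _ _ _ _ _ _ _ _ k N

/-! ### the three guards of the (ORIENT-h) docket, as instances (`hG` supplied) -/

/-- gen-0's recipe guard `GoodCtx h ι₁ c` (global bit `h`): `hG := dW_definite_of_goodCtx ι₁ c h`. -/
theorem hG_goodCtx (h : Bool) : ∀ {L : CMField} {ι₁ : L →+* ℂ} (_V : HermSpace3 L ι₁) (c : SeesawCtx L),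
    SignRecipe.GoodCtx h ι₁ c → (∀ j, 0 < (ι₁ (dW c.D j)).re) ∨ ∀ j, (ι₁ (dW c.D j)).re < 0 :=
  fun {_L} {ι₁} _V c hc => dW_definite_of_goodCtx ι₁ c h hc

/-- the ORIENTED recipe guard `GoodCtx (hb L ι₁) ι₁ c` ((o) of the (ORIENT-h) ruling; `hb := orientBitι` of record). -/
theorem hG_goodCtxO (hb : ∀ L : CMField, ((L : Type) →+* ℂ) → Bool) : ∀ {L : CMField} {ι₁ : L →+* ℂ} (_V : HermSpace3 L ι₁) (c : SeesawCtx L),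
    SignRecipe.GoodCtx (hb L ι₁) ι₁ c → (∀ j, 0 < (ι₁ (dW c.D j)).re) ∨ ∀ j, (ι₁ (dW c.D j)).re < 0 :=
  fun {L} {ι₁} _V c hc => dW_definite_of_goodCtx ι₁ c (hb L ι₁) hc

/-- the CANONICAL-REPRESENTATIVE + oriented guard `(InfinitePlace.mk ι₁).embedding = ι₁ ∧ GoodCtx (hb L ι₁) ι₁ c` ((c̄)+(o), glue-1 G1/G3). -/
theorem hG_goodCtxOG (hb : ∀ L : CMField, ((L : Type) →+* ℂ) → Bool) : ∀ {L : CMField} {ι₁ : L →+* ℂ} (_V : HermSpace3 L ι₁) (c : SeesawCtx L),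
    ((NumberField.InfinitePlace.mk ι₁).embedding = ι₁ ∧ SignRecipe.GoodCtx (hb L ι₁) ι₁ c) →
      (∀ j, 0 < (ι₁ (dW c.D j)).re) ∨ ∀ j, (ι₁ (dW c.D j)).re < 0 :=
  fun {L} {ι₁} _V c hc => dW_definite_of_goodCtx ι₁ c (hb L ι₁) hc.2

end SInstance

end HodgeCM.Model

end
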